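import Literature.NumberTheory.Automorphic.UnitaryRankTwoTorusLocalClassRamifiedBit     -- ★-to-be B-p12 (g29) FILE 4: `normalForm_bit_readout`, `normalForm_bit_readout_modular`
import HarnessLib

/-!
# [LabesseLanglands1979 §2 pp. 8–9; Rogawski1990 §4.9] road «R1-ram» (tamely RAMIFIED place), brick R-3 FILE 5: THE SIGN LAW PER SPHERE —
# the bit `e` of LEMMA U′ depends on the fixed lattice only through `(N + i)∕2`:  `e = 0 ⟺ (−1)^{(N+i)∕2+1}·c·u·θ` has square residue

Topic `NumberTheory/Automorphic`; namespace `Literature.NumberTheory.Automorphic`.  THEOREMS ONLY (no definition, no instance, no notation, no named fact, no `sorry`).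
Cell `pub/hodgecm-mathlib` (D-0151), crux H413 = `stmt-HodgeConjecture-24833`, line «N6nsGerm», residue `RankOneUnstableTransferNonsplitCMERamified` of #159; LEAD F0P3a-plan (g10);
architect A-p16 (g27) RULING A-17 (a) §4 (ii) («sign = B-p12 R-3»); numerical certificate B-p12 (g29) table 68cf7048, READINGS (1) (2) (4) — reproduced here for ALL `q`:
type A (edge, odd `i`): `ε = ω((−1)^{(N+i)∕2+1}·c·u·θ)`; type B (vertex, even `i`): `ε = ω((−1)^{(N+i+1)∕2+1}·c·u·ϖθ♯)`.
HONEST LABEL: HC_CM is proved only modulo the printed citations (the 2 remaining named inputs hLiu418, h413) until rung 0 closes; nothing printed is asserted here.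

MATHEMATICS.  Let `k ∈ U(J)(𝒪)` be torus-regular with eigenvalues `a ≠ c` (norm-one units, `a − c = ϖ^N u`), in normal form with bit `e` (files 1–4), and let `v ∈ F²` span
the `a`-eigenline of `k`, `θ := h(v, v)`.  (S1) For `y := (k − c)x` (an `a`-eigenvector, as `(k−a)(k−c) = 0`) unitarity gives `h(y, kx) = a·h(y, x)`, hence
`(a − c)·h(y, x) = h(y, y) = σξ·ξ·θ` (`y = ξv`).  (S2) `σ` preserves the valuation (`σ² = 1`, `σ𝒪 = 𝒪`), so `|ξ|² = |ϖ|^{M}` where `ϖ^M` collects the powers; since `ϖ` is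
uniformizing, `M` is EVEN and `ξ = ϖ^{M∕2}ξ₀` with `ξ₀` a unit; at `σϖ = −ϖ`: `σξ·ξ = (−1)^{M∕2}ϖ^M·σξ₀ξ₀` and `σξ₀ξ₀` has SQUARE residue.  (S3) With file 4's test value
`T(x) = −cϖ^{−i}h((k−c)x, x)` (a unit for a suitable `x`, square residue iff `e = 0`): `T = (−1)^{M∕2+1}·σξ₀ξ₀·θ₀·c·u⁻¹`, `M = N + i` and `θ₀ = θ` at an edge (`J₀`),
`M = N + i + 1` and `θ₀ = ϖθ♯` at a vertex (`J♯`, where `h♯` is skew so `θ♯` is anti-fixed of odd valuation).  Heads: **`normalForm_bit_iff_of_eigenline`** (edge) and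
**`normalForm_bit_iff_of_eigenline_modular`** (vertex).  For the R-5b assembler: `v = g⁻¹e_a` and `θ = h₀` in A-p01 (g21)'s diagonal-unit Gram frame; the factor `ω(c·u·θ)` is
lattice-free and is what B-p10 (g26)'s `Δ` at the ramified place compensates; the sphere dependence is `ω(−1)^{(N+i)∕2}` exactly as in table 68cf7048.

## References
* [LabesseLanglands1979] J.-P. Labesse, R. P. Langlands, *L-indistinguishability for SL(2)*, Canad. J. Math. 31 (1979): §2, Lemma 2.1, pp. 8–9 (ramified shells and their signs).
* [Rogawski1990] J. D. Rogawski, *Automorphic Representations of Unitary Groups in Three Variables*, Ann. of Math. Stud. 123 (1990): §4.9 Lemma 4.9.3 p. 56.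
* [Jacobowitz1962] R. Jacobowitz, *Hermitian forms over local fields*, Amer. J. Math. 84 (1962): §4, §8. [Serre1979] J.-P. Serre, *Local Fields* (1979): Ch. V §3.
-/

set_option autoImplicit false

noncomputable section

open scoped ValuativeRel Matrix MatrixGroups
open Matrix ValuativeRel

namespace Literature.NumberTheory.Automorphic

variable {F : Type*} [Field F] [ValuativeRel F]

section Bookkeeping
variable (σ : F →+* F)

omit [ValuativeRel F] in
/-- `(Mv)_r = M_{r0}v₀ + M_{r1}v₁`. [cite: Jacobowitz1962, §4] -/
private theorem mulVec_two_apply (M : Matrix (Fin 2) (Fin 2) F) (v : Fin 2 → F) (r : Fin 2) : (M *ᵥ v) r = M r 0 * v 0 + M r 1 * v 1 := by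
  show (fun j => M r j) ⬝ᵥ v = _
  rw [Matrix.vec2_dotProduct]

omit [ValuativeRel F] in
/-- The pairing `h(y, z) = Σ_r σ(y_r)(Jz)_r` on `F²`, expanded. [cite: Jacobowitz1962, §4] -/
private theorem pairing_two (J : Matrix (Fin 2) (Fin 2) F) (y z : Fin 2 → F) :
    (fun r => σ (y r)) ⬝ᵥ (J *ᵥ z) = σ (y 0) * (J 0 0 * z 0 + J 0 1 * z 1) + σ (y 1) * (J 1 0 * z 0 + J 1 1 * z 1) := by
  rw [Matrix.vec2_dotProduct, mulVec_two_apply, mulVec_two_apply]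

omit [ValuativeRel F] in
/-- Pairing invariance under a `J`-unitary `κ`: `h(κy, κz) = h(y, z)`. [cite: Jacobowitz1962, §4] -/
private theorem pairing_mulVec_eq (J κ : Matrix (Fin 2) (Fin 2) F) (hκU : (κ.map σ)ᵀ * J * κ = J) (y z : Fin 2 → F) :
    (fun r => σ ((κ *ᵥ y) r)) ⬝ᵥ (J *ᵥ (κ *ᵥ z)) = (fun r => σ (y r)) ⬝ᵥ (J *ᵥ z) := by
  have h := fun r s => congr_fun (congr_fun hκU r) s
  have h00 := h 0 0; have h01 := h 0 1; have h10 := h 1 0; have h11 := h 1 1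
  simp only [Matrix.mul_apply, Matrix.transpose_apply, Matrix.map_apply, Fin.sum_univ_two] at h00 h01 h10 h11
  rw [pairing_two, pairing_two]
  simp only [mulVec_two_apply, map_add, map_mul]
  linear_combination (σ (y 0) * z 0) * h00 + (σ (y 0) * z 1) * h01 + (σ (y 1) * z 0) * h10 + (σ (y 1) * z 1) * h11

omit [ValuativeRel F] in
/-- `h(ξv, ξv) = σξ·ξ·h(v, v)`. [cite: Jacobowitz1962, §4] -/
private theorem pairing_smul_smul (J : Matrix (Fin 2) (Fin 2) F) (ξ : F) (v : Fin 2 → F) :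
    (fun r => σ ((ξ • v) r)) ⬝ᵥ (J *ᵥ (ξ • v)) = σ ξ * ξ * ((fun r => σ (v r)) ⬝ᵥ (J *ᵥ v)) := by
  rw [pairing_two, pairing_two]; simp only [Pi.smul_apply, smul_eq_mul, map_mul]; ring

omit [ValuativeRel F] in
/-- `(k − a)(k − c) = 0` ⇒ `y := (k − c)x` is an `a`-eigenvector: `ky = a·y`. [cite: Jacobowitz1962, §4] -/
private theorem mulVec_eq_smul_of_mul_eq_zero {k : Matrix (Fin 2) (Fin 2) F} {a c : F} (hac : (k - a • 1) * (k - c • 1) = 0) (x : Fin 2 → F) :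
    k *ᵥ ((k - c • 1) *ᵥ x) = a • ((k - c • 1) *ᵥ x) := by
  have h0 : (k - a • (1 : Matrix (Fin 2) (Fin 2) F)) *ᵥ ((k - c • 1) *ᵥ x) = 0 := by
    rw [Matrix.mulVec_mulVec, hac, Matrix.zero_mulVec]
  rw [Matrix.sub_mulVec, Matrix.smul_mulVec, Matrix.one_mulVec] at h0
  exact sub_eq_zero.1 h0

omit [ValuativeRel F] in
/-- (S1) **Eigenline evaluation.**  `k` `J`-unitary, `σa·a = 1`, `(k − a)(k − c) = 0`, `y := (k − c)x` ⇒ `(a − c)·h(y, x) = h(y, y)`.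
[cite: LabesseLanglands1979, §2 pp. 8–9] [cite: Jacobowitz1962, §4] -/
private theorem sub_mul_pairing_eq (J k : Matrix (Fin 2) (Fin 2) F) (hkU : (k.map σ)ᵀ * J * k = J) {a c : F} (ha : σ a * a = 1)
    (hac : (k - a • 1) * (k - c • 1) = 0) (x : Fin 2 → F) :
    (a - c) * ((fun r => σ (((k - c • 1) *ᵥ x) r)) ⬝ᵥ (J *ᵥ x)) =
      (fun r => σ (((k - c • 1) *ᵥ x) r)) ⬝ᵥ (J *ᵥ ((k - c • 1) *ᵥ x)) := by
  have hky := mulVec_eq_smul_of_mul_eq_zero hac x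
  set y : Fin 2 → F := (k - c • 1) *ᵥ x with hy
  have h1 := pairing_mulVec_eq σ J k hkU y x
  rw [hky] at h1
  have hy0 : y 0 = k 0 0 * x 0 + k 0 1 * x 1 - c * x 0 := by rw [hy, mulVec_two_apply]; simp; ring
  have hy1 : y 1 = k 1 0 * x 0 + k 1 1 * x 1 - c * x 1 := by rw [hy, mulVec_two_apply]; simp; ring
  clear_value y
  rw [pairing_two, pairing_two] at h1 ⊢
  simp only [mulVec_two_apply, Pi.smul_apply, smul_eq_mul, map_mul] at h1 ⊢
  linear_combination (-a) * h1
    + (σ (y 0) * (J 0 0 * (k 0 0 * x 0 + k 0 1 * x 1) + J 0 1 * (k 1 0 * x 0 + k 1 1 * x 1)) +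
        σ (y 1) * (J 1 0 * (k 0 0 * x 0 + k 0 1 * x 1) + J 1 1 * (k 1 0 * x 0 + k 1 1 * x 1))) * ha
    - (σ (y 0) * J 0 0 + σ (y 1) * J 1 0) * hy0 - (σ (y 0) * J 0 1 + σ (y 1) * J 1 1) * hy1

omit [ValuativeRel F] in
/-- In a field, `b ≠ 0` ⇒ (`a·b²` is a square iff `a` is). [cite: Serre1979, Ch. V §3] -/
private theorem isSquare_mul_sq_iff' {K : Type*} [Field K] {a b : K} (hb : b ≠ 0) : IsSquare (a * b ^ 2) ↔ IsSquare a := by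
  refine ⟨fun ⟨r, hr⟩ => ⟨r * b⁻¹, ?_⟩, fun ⟨r, hr⟩ => ⟨r * b, by rw [hr]; ring⟩⟩
  have : a = a * b ^ 2 * (b⁻¹) ^ 2 := by field_simp
  rw [this, hr]; ring

/-- `|x| = 1 ⇒ x ∈ 𝒪`. [cite: Serre1979, Ch. V §2] -/
private theorem mem_of_valuation_eq_one' {x : F} (hx : valuation F x = 1) : x ∈ 𝒪[F] :=
  (Valuation.mem_integer_iff _ _).2 hx.le

/-- `|x| = 1 ⇒ x ≠ 0`. [cite: Serre1979, Ch. V §2] -/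
private theorem ne_zero_of_valuation_eq_one' {x : F} (hx : valuation F x = 1) : x ≠ 0 := by
  intro h; rw [h, map_zero] at hx; exact zero_ne_one hx

end Bookkeeping

section Core

variable (σ : F →+* F) {ϖ : F} (hϖ : IsUniformizingElement ϖ) (hσϖ : σ ϖ = -ϖ)
  (σO : 𝒪[F] →+* 𝒪[F]) (hσO : ∀ x : 𝒪[F], ((σO x : 𝒪[F]) : F) = σ x) (hσσ : ∀ x, σO (σO x) = x)

include hσO in
/-- `σ(𝒪) ⊆ 𝒪`. [cite: Serre1979, Ch. V §2] -/
private theorem map_mem_integer' {x : F} (hx : x ∈ 𝒪[F]) : σ x ∈ 𝒪[F] := by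
  rw [← hσO ⟨x, hx⟩]; exact SetLike.coe_mem _

include hσO hσσ in
/-- `σ(σ x) = x` on ALL of `F` (on `𝒪` by hypothesis, elsewhere via `x⁻¹ ∈ 𝒪`). [cite: Serre1979, Ch. V §2] -/
private theorem map_map_eq (x : F) : σ (σ x) = x := by
  have hO : ∀ {z : F}, z ∈ 𝒪[F] → σ (σ z) = z := fun {z} hz => by
    have h1 : σ z = ((σO ⟨z, hz⟩ : 𝒪[F]) : F) := (hσO ⟨z, hz⟩).symm
    rw [h1, ← hσO, hσσ]
  by_cases hx : x ∈ 𝒪[F]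
  · exact hO hx
  · have hx0 : x ≠ 0 := by rintro rfl; exact hx (𝒪[F]).zero_mem
    have hlt : 1 < valuation F x := not_le.1 fun h => hx ((Valuation.mem_integer_iff _ _).2 h)
    have hinv : x⁻¹ ∈ 𝒪[F] := (Valuation.mem_integer_iff _ _).2 (by rw [map_inv₀]; exact inv_le_one_of_one_le₀ hlt.le)
    have h := hO hinv
    rw [map_inv₀, map_inv₀, _root_.inv_inj] at h
    exact h

include hσO hσσ in
/-- (S2a) `σ` PRESERVES THE VALUATION: if `|σz| < |z|` then `t := σz∕z ∈ 𝔪` while `σt = t⁻¹ ∈ 𝒪` — absurd. [cite: Serre1979, Ch. V §2] -/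
private theorem valuation_map_eq (x : F) : valuation F (σ x) = valuation F x := by
  have key : ∀ z : F, z ≠ 0 → ¬ valuation F (σ z) < valuation F z := by
    intro z hz hlt
    have hσz0 : σ z ≠ 0 := (map_ne_zero σ).2 hz
    have hvz : valuation F z ≠ 0 := (Valuation.ne_zero_iff _).2 hz
    have ht : valuation F (σ z * z⁻¹) < 1 := by
      refine not_le.1 fun hge => ?_
      have h2 : valuation F z ≤ valuation F (σ z * z⁻¹) * valuation F z := le_mul_of_one_le_left' hge
      rw [← map_mul, inv_mul_cancel_right₀ hz] at h2
      exact not_lt.2 h2 hlt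
    have htO : σ z * z⁻¹ ∈ 𝒪[F] := (Valuation.mem_integer_iff _ _).2 ht.le
    have hσt : σ (σ z * z⁻¹) = (σ z * z⁻¹)⁻¹ := by rw [map_mul, map_inv₀, map_map_eq σ σO hσO hσσ, mul_inv, inv_inv, mul_comm]
    have hinvO : (σ z * z⁻¹)⁻¹ ∈ 𝒪[F] := by rw [← hσt]; exact map_mem_integer' σ σO hσO htO
    have hle : valuation F (σ z * z⁻¹)⁻¹ ≤ 1 := (Valuation.mem_integer_iff _ _).1 hinvO
    have h1 : valuation F (σ z * z⁻¹ * (σ z * z⁻¹)⁻¹) < 1 := by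
      rw [map_mul]; exact mul_lt_one_of_lt_of_le ht hle
    rw [mul_inv_cancel₀ (mul_ne_zero hσz0 (inv_ne_zero hz)), map_one] at h1
    exact lt_irrefl _ h1
  by_cases hx : x = 0
  · rw [hx, map_zero]
  rcases lt_trichotomy (valuation F (σ x)) (valuation F x) with h | h | h
  · exact absurd h (key x hx)
  · exact h
  · refine absurd ?_ (key (σ x) ((map_ne_zero σ).2 hx))
    rwa [map_map_eq σ σO hσO hσσ]

include hϖ in
/-- (S2b) VALUE-GROUP PARITY.  `|ξ·ξ| = |ϖ^M|` ⇒ `M` is even and `ξ₀ := ξ·(ϖ^{M∕2})⁻¹` is a unit — because `ϖ` is uniformizing (no square root of `|ϖ|`), no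
discreteness needed. [cite: Serre1979, Ch. V §2] -/
private theorem even_and_valuation_eq_one {ξ : F} {M : ℕ} (h : valuation F (ξ * ξ) = valuation F (ϖ ^ M)) :
    Even M ∧ valuation F (ξ * (ϖ ^ (M / 2))⁻¹) = 1 := by
  have hϖ0 : ϖ ≠ 0 := hϖ.ne_zero
  obtain ⟨j, hj | hj⟩ := Nat.even_or_odd' M
  · have hMj : M / 2 = j := by omega
    set h₀ : F := ξ * (ϖ ^ j)⁻¹ with hh₀
    have hsq : valuation F (h₀ * h₀) = 1 := by
      have e1 : h₀ * h₀ * ϖ ^ M = ξ * ξ := by rw [hh₀, hj, pow_mul, sq]; field_simp; ring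
      have e2 : valuation F (h₀ * h₀) * valuation F (ϖ ^ M) = valuation F (ϖ ^ M) := by rw [← map_mul, e1, h]
      have hM0 : valuation F (ϖ ^ M) ≠ 0 := by rw [map_pow]; exact pow_ne_zero _ ((Valuation.ne_zero_iff _).2 hϖ0)
      exact mul_right_cancel₀ hM0 (by rw [e2, one_mul])
    refine ⟨⟨j, by omega⟩, ?_⟩
    rw [hMj, ← hh₀]
    rcases lt_trichotomy (valuation F h₀) 1 with hl | he | hg
    · have := mul_lt_one_of_lt_of_le hl hl.le; rw [← map_mul, hsq] at this; exact absurd this (lt_irrefl _)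
    · exact he
    · have hl : valuation F h₀⁻¹ < 1 := by rw [map_inv₀]; exact inv_lt_one_of_one_lt₀ hg
      have := mul_lt_one_of_lt_of_le hl hl.le
      rw [← map_mul, ← mul_inv, map_inv₀, hsq, inv_one] at this; exact absurd this (lt_irrefl _)
  · exfalso
    set h₀ : F := ξ * (ϖ ^ j)⁻¹ with hh₀
    have hsq : valuation F (h₀ * h₀) = valuation F ϖ := by
      have e1 : h₀ * h₀ * ϖ ^ (2 * j) = ξ * ξ := by rw [hh₀, pow_mul, sq]; field_simp; ring
      have e2 : valuation F (h₀ * h₀) * valuation F (ϖ ^ (2 * j)) = valuation F ϖ * valuation F (ϖ ^ (2 * j)) := by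
        rw [← map_mul, e1, h, hj, pow_succ, map_mul, mul_comm]
      have hM0 : valuation F (ϖ ^ (2 * j)) ≠ 0 := by rw [map_pow]; exact pow_ne_zero _ ((Valuation.ne_zero_iff _).2 hϖ0)
      exact mul_right_cancel₀ hM0 e2
    rcases lt_or_ge (valuation F h₀) 1 with hl | hge
    · have hh₀O : h₀ ∈ 𝒪[F] := (Valuation.mem_integer_iff _ _).2 hl.le
      obtain ⟨w, hw, hw'⟩ := hϖ.exists_eq_mul hh₀O hl
      have hw1 : valuation F w ≤ 1 := (Valuation.mem_integer_iff _ _).1 hw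
      rw [hw', show ϖ * w * (ϖ * w) = ϖ * (ϖ * w * w) by ring, map_mul] at hsq
      have hvϖ : valuation F ϖ ≠ 0 := (Valuation.ne_zero_iff _).2 hϖ0
      have h1 : valuation F (ϖ * w * w) = 1 := mul_left_cancel₀ hvϖ (by rw [hsq, mul_one])
      have h2 : valuation F (ϖ * w * w) < 1 := by
        rw [map_mul, map_mul]; exact mul_lt_one_of_lt_of_le (mul_lt_one_of_lt_of_le hϖ.valuation_lt_one hw1) hw1
      rw [h1] at h2; exact lt_irrefl _ h2
    · have : 1 ≤ valuation F (h₀ * h₀) := by rw [map_mul]; exact Left.one_le_mul hge hge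
      rw [hsq] at this; exact not_lt.2 this hϖ.valuation_lt_one

include hϖ hσϖ hσO hσσ in
/-- (S3) SIGN CORE.  `T, u, c, θ₀` units (`σc·c = 1`), `ξ ∈ F` with `σξ·ξ·θ₀ = −ϖ^M·(u·σc·T)` ⇒ `M` is even and, for `S` with `S = (−1)^{M∕2+1}·c·u·θ₀`,
`T` has square residue iff `S` does (`T = S·σξ₀ξ₀·u⁻²` with `ξ₀` a unit and `σξ₀ξ₀` of square residue). [cite: LabesseLanglands1979, §2 pp. 8–9] [cite: Serre1979, Ch. V §3] -/
private theorem sign_core (hres : ∀ x : 𝒪[F], σO x - x ∈ IsLocalRing.maximalIdeal 𝒪[F])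
    {ξ θ₀ u c T : F} {M : ℕ} (hT1 : valuation F T = 1) (hu1 : valuation F u = 1) (hc : σ c * c = 1) (hc1 : valuation F c = 1)
    (hθ1 : valuation F θ₀ = 1) (hM : σ ξ * ξ * θ₀ = -(ϖ ^ M * (u * σ c * T))) :
    Even M ∧ ∀ TO S : 𝒪[F], (TO : F) = T → (S : F) = (-1) ^ (M / 2 + 1) * c * u * θ₀ →
      (IsSquare (IsLocalRing.residue 𝒪[F] TO) ↔ IsSquare (IsLocalRing.residue 𝒪[F] S)) := by
  have hϖ0 : ϖ ≠ 0 := hϖ.ne_zero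
  have hσpow : ∀ n : ℕ, σ (ϖ ^ n) = (-1) ^ n * ϖ ^ n := fun n => by rw [map_pow, hσϖ, neg_eq_neg_one_mul, mul_pow]
  have hσc1 : valuation F (σ c) = 1 := by rw [valuation_map_eq σ σO hσO hσσ, hc1]
  have hval : valuation F (ξ * ξ) = valuation F (ϖ ^ M) := by
    have h := congrArg (valuation F) hM
    rw [Valuation.map_neg, map_mul, map_mul, map_mul, map_mul, map_mul, valuation_map_eq σ σO hσO hσσ, hθ1, hu1, hσc1, hT1,
      mul_one, mul_one, mul_one, mul_one] at h
    rw [map_mul, h]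
  obtain ⟨hev, hξ₀1⟩ := even_and_valuation_eq_one hϖ hval
  obtain ⟨n₀, hn₀⟩ := hev
  have hMn : M / 2 = n₀ := by omega
  rw [hMn] at hξ₀1
  refine ⟨⟨n₀, hn₀⟩, fun TO S hTO hS => ?_⟩
  rw [hMn] at hS
  set ξ₀ : F := ξ * (ϖ ^ n₀)⁻¹ with hξ₀
  have hξ : ξ = ϖ ^ n₀ * ξ₀ := by rw [hξ₀, mul_comm, inv_mul_cancel_right₀ (pow_ne_zero _ hϖ0)]
  have hξ₀O : ξ₀ ∈ 𝒪[F] := mem_of_valuation_eq_one' hξ₀1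
  clear_value ξ₀
  have hMpow : (ϖ : F) ^ M = ϖ ^ n₀ * ϖ ^ n₀ := by rw [← pow_add, hn₀]
  have key : (-1) ^ n₀ * (σ ξ₀ * ξ₀) * θ₀ = -(u * σ c * T) := by
    have h1 : ϖ ^ M * ((-1) ^ n₀ * (σ ξ₀ * ξ₀) * θ₀) = σ ξ * ξ * θ₀ := by
      rw [hξ, map_mul, hσpow, hMpow]; ring
    exact mul_left_cancel₀ (pow_ne_zero _ hϖ0) (by rw [h1, hM]; ring)
  have hu0 : u ≠ 0 := ne_zero_of_valuation_eq_one' hu1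
  have hσc0 : σ c ≠ 0 := ne_zero_of_valuation_eq_one' hσc1
  have hσcinv : (σ c)⁻¹ = c := (eq_inv_of_mul_eq_one_right hc).symm
  have key' : u * σ c * T = -((-1) ^ n₀ * (σ ξ₀ * ξ₀) * θ₀) := by linear_combination key
  have h0 : u * σ c ≠ 0 := mul_ne_zero hu0 hσc0
  have hT : T = (-1) ^ (n₀ + 1) * c * u⁻¹ * θ₀ * (σ ξ₀ * ξ₀) := by
    calc T = (u * σ c)⁻¹ * (u * σ c * T) := by rw [← mul_assoc, inv_mul_cancel₀ h0, one_mul]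
      _ = (u * σ c)⁻¹ * -((-1) ^ n₀ * (σ ξ₀ * ξ₀) * θ₀) := by rw [key']
      _ = (-1) ^ (n₀ + 1) * c * u⁻¹ * θ₀ * (σ ξ₀ * ξ₀) := by rw [mul_inv, hσcinv, pow_succ]; ring
  obtain ⟨X₀, hX₀⟩ : ∃ X₀ : 𝒪[F], (X₀ : F) = ξ₀ := ⟨⟨ξ₀, hξ₀O⟩, rfl⟩
  obtain ⟨uO, huO⟩ : ∃ uO : 𝒪[F], (uO : F) = u := ⟨⟨u, mem_of_valuation_eq_one' hu1⟩, rfl⟩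
  have huU : IsUnit uO :=
    (Valuation.integer.integers (valuation F)).isUnit_iff_valuation_eq_one.2 (by rw [show (algebraMap 𝒪[F] F) uO = u from huO]; exact hu1)
  obtain ⟨w, hw⟩ := huU.exists_right_inv
  have hw' : u * (w : F) = 1 := by have := congrArg Subtype.val hw; rw [← huO]; simpa using this
  have hwinv : (w : F) = u⁻¹ := eq_inv_of_mul_eq_one_right hw'
  have hTOeq : TO = S * (X₀ * σO X₀) * w ^ 2 := by
    apply Subtype.ext
    push_cast
    rw [hTO, hS, hσO, hT, hX₀, hwinv]
    field_simp
  have hX₀u : IsLocalRing.residue 𝒪[F] X₀ ≠ 0 :=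
    (IsLocalRing.residue_ne_zero_iff_isUnit X₀).2 ((Valuation.integer.integers (valuation F)).isUnit_iff_valuation_eq_one.2
      (by rw [show (algebraMap 𝒪[F] F) X₀ = ξ₀ from hX₀]; exact hξ₀1))
  have hwu : IsLocalRing.residue 𝒪[F] w ≠ 0 := (IsLocalRing.residue_ne_zero_iff_isUnit w).2 (IsUnit.of_mul_eq_one_right _ hw)
  have hres2 : IsLocalRing.residue 𝒪[F] TO = IsLocalRing.residue 𝒪[F] S * (IsLocalRing.residue 𝒪[F] X₀ * IsLocalRing.residue 𝒪[F] w) ^ 2 := by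
    rw [hTOeq]; simp only [map_mul, map_pow, LocalFields.RamifiedQuadraticNorm.residue_map_eq σO hres X₀]; ring
  rw [hres2, isSquare_mul_sq_iff' (mul_ne_zero hX₀u hwu)]

include hϖ hσϖ hσO hσσ in
/-- **SIGN LAW PER SPHERE (edge ∕ self-dual lattice, `J₀ = [[0,1],[1,0]]`, odd depth `i`).**  In the setting of ★ `normalForm_bit_readout` (normal form
`J₀κᴴJ₀·k·κ = c(1 + ϖ^i[[0,η^e],[0,0]]) + ϖ^mR`, bit `e ≤ 1`), let moreover `k` be `J₀`-unitary with `(k − a)(k − c) = 0`, `σa·a = 1`, `a − c = ϖ^N·u` with `u` a unit, and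
let `v ∈ F²` span the `a`-eigenline of `k` (`kz = az ⇒ z ∈ Fv`) with `θ := h(v, v) = Σ_r σ(v_r)(J₀v)_r` a UNIT.  Then `N + i` is EVEN and
`e = 0 ⟺ (−1)^{(N+i)∕2+1}·c·u·θ` has square residue — the bit depends on the lattice only through `(N + i)∕2` (table 68cf7048 READINGS (1)(2)(4), type A).
[cite: LabesseLanglands1979, §2 Lemma 2.1 pp. 8–9] [cite: Rogawski1990, §4.9 Lemma 4.9.3 p. 56] [cite: Jacobowitz1962, §8] [cite: Serre1979, Ch. V §3] -/
theorem normalForm_bit_iff_of_eigenline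
    (hres : ∀ x : 𝒪[F], σO x - x ∈ IsLocalRing.maximalIdeal 𝒪[F])
    {η : 𝒪[F]} (hηu : IsUnit η) (hση : σO η = η) (hη : ¬ IsSquare (IsLocalRing.residue 𝒪[F] η))
    {k κ R : Matrix (Fin 2) (Fin 2) F} (hκO : ∀ r s, κ r s ∈ 𝒪[F]) (hκU : (κ.map σ)ᵀ * !![0, 1; 1, 0] * κ = !![0, 1; 1, 0])
    (hRO : ∀ r s, R r s ∈ 𝒪[F]) {a c : F} (ha : σ a * a = 1) (hc : σ c * c = 1) (hc1 : valuation F c = 1)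
    (hkU : (k.map σ)ᵀ * !![0, 1; 1, 0] * k = !![0, 1; 1, 0]) (hac : (k - a • 1) * (k - c • 1) = 0)
    {N : ℕ} {u : F} (hu : a - c = ϖ ^ N * u) (hu1 : valuation F u = 1)
    {i m : ℕ} (him : i < m) (hi : Odd i) {e : ℕ} (he : e ≤ 1)
    (hnf : !![0, 1; 1, 0] * (κ.map σ)ᵀ * !![0, 1; 1, 0] * k * κ = c • (1 + ϖ ^ i • !![0, ((η : 𝒪[F]) : F) ^ e; 0, 0]) + ϖ ^ m • R)
    (v : Fin 2 → F) (hv : ∀ z : Fin 2 → F, k *ᵥ z = a • z → ∃ ξ : F, z = ξ • v)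
    (hθ : valuation F ((fun r => σ (v r)) ⬝ᵥ (!![0, 1; 1, 0] *ᵥ v)) = 1) :
    Even (N + i) ∧ ∀ S : 𝒪[F], (S : F) = (-1) ^ ((N + i) / 2 + 1) * c * u * ((fun r => σ (v r)) ⬝ᵥ (!![0, 1; 1, 0] *ᵥ v)) →
      (IsSquare (IsLocalRing.residue 𝒪[F] S) ↔ e = 0) := by
  have hϖ0 : ϖ ≠ 0 := hϖ.ne_zero
  obtain ⟨hall, x, hx, hTx⟩ := normalForm_bit_readout σ hϖ hσϖ σO hσO hres hηu hση hη hκO hκU hRO hc hc1 him hi he hnf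
  obtain ⟨hTxO, hread⟩ := hall x hx
  set T : F := -c * ϖ ^ (-(i : ℤ)) * ((fun r => σ (((k - c • 1) *ᵥ x) r)) ⬝ᵥ (!![0, 1; 1, 0] *ᵥ x)) with hTdef
  have hiff := hread ⟨T, hTxO⟩ rfl ((Valuation.integer.integers (valuation F)).isUnit_iff_valuation_eq_one.2 hTx)
  obtain ⟨ξ, hyξ⟩ := hv ((k - c • 1) *ᵥ x) (mulVec_eq_smul_of_mul_eq_zero hac x)
  have hS1 := sub_mul_pairing_eq σ !![0, 1; 1, 0] k hkU ha hac x
  rw [hyξ, pairing_smul_smul] at hS1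
  set θ : F := (fun r => σ (v r)) ⬝ᵥ (!![0, 1; 1, 0] *ᵥ v) with hθdef
  set P : F := (fun r => σ ((ξ • v) r)) ⬝ᵥ (!![0, 1; 1, 0] *ᵥ x) with hPdef
  clear_value θ P T
  rw [hyξ, ← hPdef] at hTdef
  have hϖ0i : ϖ ^ (-(i : ℤ)) * ϖ ^ i = 1 := by rw [← zpow_natCast, ← zpow_add₀ hϖ0, neg_add_cancel, zpow_zero]
  have hM : σ ξ * ξ * θ = -(ϖ ^ (N + i) * (u * σ c * T)) := by
    rw [← hS1, hu, hTdef, pow_add]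
    linear_combination (-(ϖ ^ N * u * P)) * hc + (-(ϖ ^ N * u * P * σ c * c)) * hϖ0i
  obtain ⟨hev, hcore⟩ := sign_core σ hϖ hσϖ σO hσO hσσ hres hTx hu1 hc hc1 hθ hM
  exact ⟨hev, fun S hS => (hcore ⟨T, hTxO⟩ S rfl hS).symm.trans hiff⟩

include hϖ hσϖ hσO hσσ in
/-- **SIGN LAW PER SPHERE (vertex ∕ `ϖ`-modular lattice, `J♯ = [[0,−1],[1,0]]`, even depth `i`).**  As `normalForm_bit_iff_of_eigenline`, in the setting of
★ `normalForm_bit_readout_modular`; here `h♯(y,z) = Σ_r σ(y_r)(J♯z)_r` is skew, `θ♯ := h♯(v, v)` is anti-fixed, and the normalisation is `|ϖ·θ♯| = 1`.  Then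
`N + i + 1` is EVEN and `e = 0 ⟺ (−1)^{(N+i+1)∕2+1}·c·u·(ϖθ♯)` has square residue (table 68cf7048, type B).
[cite: LabesseLanglands1979, §2 Lemma 2.1 pp. 8–9] [cite: Rogawski1990, §4.9 Lemma 4.9.3 p. 56] [cite: Jacobowitz1962, §8] [cite: Serre1979, Ch. V §3] -/
theorem normalForm_bit_iff_of_eigenline_modular
    (hres : ∀ x : 𝒪[F], σO x - x ∈ IsLocalRing.maximalIdeal 𝒪[F])
    {η : 𝒪[F]} (hηu : IsUnit η) (hση : σO η = η) (hη : ¬ IsSquare (IsLocalRing.residue 𝒪[F] η))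
    {k κ R : Matrix (Fin 2) (Fin 2) F} (hκO : ∀ r s, κ r s ∈ 𝒪[F]) (hκU : (κ.map σ)ᵀ * !![0, -1; 1, 0] * κ = !![0, -1; 1, 0])
    (hRO : ∀ r s, R r s ∈ 𝒪[F]) {a c : F} (ha : σ a * a = 1) (hc : σ c * c = 1) (hc1 : valuation F c = 1)
    (hkU : (k.map σ)ᵀ * !![0, -1; 1, 0] * k = !![0, -1; 1, 0]) (hac : (k - a • 1) * (k - c • 1) = 0)
    {N : ℕ} {u : F} (hu : a - c = ϖ ^ N * u) (hu1 : valuation F u = 1)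
    {i m : ℕ} (him : i < m) (hi : Even i) {e : ℕ} (he : e ≤ 1)
    (hnf : !![0, 1; -1, 0] * (κ.map σ)ᵀ * !![0, -1; 1, 0] * k * κ = c • (1 + ϖ ^ i • !![0, ((η : 𝒪[F]) : F) ^ e; 0, 0]) + ϖ ^ m • R)
    (v : Fin 2 → F) (hv : ∀ z : Fin 2 → F, k *ᵥ z = a • z → ∃ ξ : F, z = ξ • v)
    (hθ : valuation F (ϖ * ((fun r => σ (v r)) ⬝ᵥ (!![0, -1; 1, 0] *ᵥ v))) = 1) :
    Even (N + i + 1) ∧ ∀ S : 𝒪[F], (S : F) = (-1) ^ ((N + i + 1) / 2 + 1) * c * u * (ϖ * ((fun r => σ (v r)) ⬝ᵥ (!![0, -1; 1, 0] *ᵥ v))) →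
      (IsSquare (IsLocalRing.residue 𝒪[F] S) ↔ e = 0) := by
  have hϖ0 : ϖ ≠ 0 := hϖ.ne_zero
  obtain ⟨hall, x, hx, hTx⟩ := normalForm_bit_readout_modular σ hϖ hσϖ σO hσO hres hηu hση hη hκO hκU hRO hc hc1 him hi he hnf
  obtain ⟨hTxO, hread⟩ := hall x hx
  set T : F := -c * ϖ ^ (-(i : ℤ)) * ((fun r => σ (((k - c • 1) *ᵥ x) r)) ⬝ᵥ (!![0, -1; 1, 0] *ᵥ x)) with hTdef
  have hiff := hread ⟨T, hTxO⟩ rfl ((Valuation.integer.integers (valuation F)).isUnit_iff_valuation_eq_one.2 hTx)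
  obtain ⟨ξ, hyξ⟩ := hv ((k - c • 1) *ᵥ x) (mulVec_eq_smul_of_mul_eq_zero hac x)
  have hS1 := sub_mul_pairing_eq σ !![0, -1; 1, 0] k hkU ha hac x
  rw [hyξ, pairing_smul_smul] at hS1
  set θ : F := (fun r => σ (v r)) ⬝ᵥ (!![0, -1; 1, 0] *ᵥ v) with hθdef
  set P : F := (fun r => σ ((ξ • v) r)) ⬝ᵥ (!![0, -1; 1, 0] *ᵥ x) with hPdef
  clear_value θ P T
  rw [hyξ, ← hPdef] at hTdef
  have hϖ0i : ϖ ^ (-(i : ℤ)) * ϖ ^ i = 1 := by rw [← zpow_natCast, ← zpow_add₀ hϖ0, neg_add_cancel, zpow_zero]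
  have hM : σ ξ * ξ * (ϖ * θ) = -(ϖ ^ (N + i + 1) * (u * σ c * T)) := by
    rw [show σ ξ * ξ * (ϖ * θ) = ϖ * (σ ξ * ξ * θ) by ring, ← hS1, hu, hTdef, pow_succ, pow_add]
    linear_combination (-(ϖ * ϖ ^ N * u * P)) * hc + (-(ϖ * ϖ ^ N * u * P * σ c * c)) * hϖ0i
  obtain ⟨hev, hcore⟩ := sign_core σ hϖ hσϖ σO hσO hσσ hres hTx hu1 hc hc1 hθ hM
  exact ⟨hev, fun S hS => (hcore ⟨T, hTxO⟩ S rfl hS).symm.trans hiff⟩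

end Core

end Literature.NumberTheory.Automorphic

end
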